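import Summits.BirchSwinnertonDyer.BirchSwinnertonDyer.Theorems.SylvesterTwoHeegnerIndexYinDefs
import Mathlib.FieldTheory.Galois.Basic
import HarnessLib

/-!
# Route `SylvesterTwoHeegnerIndex` (rung K7t), stub (C′) of item 19804 / item 19802: the TORIC
# DECOMPOSITION of Yin's point — the typed READING of the C′ mechanism (hypothesis shapes, fact-free)

Cell `bsd-cm`, seat `bsd-cm-two` (prover-bsd-cm-two-g9-0). PARTITION (D55): CornerF at `p = 2`
(B14/O12) × {`x³ + y³ = p` : `p ≡ 7 (mod 9)` prime} × `p = 2` — types-the-object-of; closes no cell and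
no item; BSD is not claimed. Route-posited statements (D-0014: problem side), NO named Literature fact
inside, nothing asserted: three `def … : Prop` + two predicates. This module imports NO `Theses` file.

THE MECHANISM (MEMO bsd-cm-two v2.10 §51–§52, FROZEN 08c1ecd6da1b763f; planner D138 (a): the cell's
DERIVED-CLAIM OF RECORD for stub (C′), pending the referee). `K = ℚ(ω)`, `p ≡ 7 (9)`, `N = 27p`,
`f = θ_ψ` the weight-`2` form of Yin, arXiv:2607.01744 §2 (`a_n ≠ 0` iff `n ≡ 1 (3)`, so `a₂(f) = 0`),
`φ : X₁(N) → E_ϖ̄`, `Z_p = ϕ∘φ([τ_r]) ∈ E_p(K)` (Yin, Thm. 2.2).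
(S1) LEMMA A+B (Hecke at the inert supersingular prime `2` + Shimura reciprocity): the EXACT identity
  `F(τ/4) + F((τ+2)/4) + ξ(2)F(τ) = 0` (`F = Σ a_n/n qⁿ`) gives `[ζ]φ(x) = −(φ(x″) + φ(σx″))` with
  `x″ = [τ_r/4]` a CM point of `2`-conductor `4`, `σ` the involution of `Gal(F(x″)/F(x′))`; the
  quadratic step `F(x″)/F(x′)` contains `K(i) = K(√−1)` (conductor `4`), `σ|_{K(i)} = c`, and
  `[F_Γ(x″) : K(i)] = 9` is ODD.
(S2) LEMMA C (trace to `K(i)`): `N·Z_p = −[ζ](R + cR) + torsion` with `N = 9`, `R ∈ E_p(K(i))`.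
(S3)+(S4) LEMMA D+E: the anti-trace `(1 − c)R` is a positive multiple of the Yuan–Zhang–Zhang toric
  period `P_{χκ}(ρ(β″)φ_A)` for the SEXTIC character `χκ` (`χ` Yin's cubic character, `κ` the quadratic
  character of `K(i)/K`), whose pair `(π_f, χκ)` has Tunnell–Saito set `Σ = {3, ∞}` (the `ε`-factor at `3`
  flips because `√−3` is inert in `K(i)` and `f₃(E_p) = 2` for `p ≡ ±2 (9)`), so by YZZ13 §1.3.2
  (`𝒫(π_A, χκ) = 0` when `Σ(𝔹) ≠ Σ(A, χκ)`; Thm. 1.3 = Tunnell 1983 / Saito 1993) EVERY such period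
  vanishes: `(1 − c)R` is torsion.
(S5) kernel algebra + Galois descent (`…Theorems.SylvesterTwoHeegnerIndexYinToric`): `Z_p ∈ 2E_p(K) + tors`,
  which is CONJECTURE C′ for one display point, hence (two g8 / x1b GEN 52) the typed C′ and item 19802.

This file TYPES the outputs of (S1)–(S4) in the tree's currency (points of `B ⊗ K`, `B ⊗ L` for an
abstract quadratic extension `L/K` — in the source `L = K(i) = ℚ(ζ₁₂)` —, Mathlib's `Point.baseChange`
and `Point.map (σ : L ≃ₐ[K] L)`), as HYPOTHESIS SHAPES:
* `TraceRelationAtTwo` — predicate: `N • ι(Y) = −θ(R + cR) + T` (reading of LEMMAS A–C);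
* `AntiTraceIsTorsion` — predicate: `R − cR` has finite order (reading of LEMMAS D–E: the coherent
  sextic toric period vanishes);
* `YinToricDecomposition` — for every `p ≡ 7 (9)`, every minimal `B ≅ E_p`, every quadratic `K ∋ ω`
  with `rank_ℤ B(K) = 2` and every rational generator `P`: ONE display point `Y ∈ B(K)` (`2`-adic unit
  `u`, `(u·qB)·ĥ(ι P) = 2⁻²·ĥ(Y)` — Yin's display for `Y = ψ([√−3]Z_p)`) TOGETHER WITH toric data
  `(L, c, θ, N, R, T)` satisfying both predicates, `Gal(L/K) = {1, c}`, `B(L)[2] = 0`, `N` odd, `T`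
  torsion. The display and the toric data are tied to the SAME point (x1b GEN 52's design remark,
  pub/bsd-cm STATUS 2026-08-27T05:40Z);
* `PublishedFactsTwoYinToric := YinHeightDisplay ∧ YinToricDecomposition` — the planner's binder name
  (D138 (c)); the consumer `yinPointTwoDivisibleSevenModNine_of_toric : PublishedFactsTwoYinToric →
  YinPointTwoDivisibleSevenModNine` is in the companion theorem file.
NOT a Literature fact (the display is PREPRINT 2026; (S1)–(S4) are a cell DERIVED-CLAIM); nothing is
asserted; no label moves; nothing booked.

## References
* H. Yin, arXiv:2607.01744 (2026), §2 (`f`, `Γ`, `ι₁`, `τ_r`), Thm. 2.2, Prop. 3.1–3.2; arXiv:2605.25917. PREPRINT.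
* X. Yuan, S.-W. Zhang, W. Zhang, *The Gross–Zagier Formula on Shimura Curves*, Ann. of Math. Stud. 184
  (2013), §1.3.2 (the functional `P_χ ∈ 𝒫(π_A, χ) ⊗ A(χ)`, `𝒫 = 0` unless `Σ(𝔹) = Σ(A, χ)`), §1.4.1
  Thm. 1.3 (Tunnell, Amer. J. Math. 105 (1983); Saito, Compositio 85 (1993)).
* MEMO bsd-cm-two v2.10 §51–§55 (HOME/frozen/MEMO-bsd-cm-two.v2.10.08c1ecd6da1b763f.md); pub/bsd-cm STATUS
  2026-08-27T05:04:35Z (planner D138) and T05:40Z (x1b GEN 52, p499913).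
-/

set_option autoImplicit false
-- the Summit-side namespace `Summit.BirchSwinnertonDyer.BirchSwinnertonDyer.…` (summit = problem) is mandated by D-0017
set_option linter.dupNamespace false

noncomputable section

open scoped Classical

open WeierstrassCurve WeierstrassCurve.Affine WeierstrassCurve.Affine.Point
  Literature.NumberTheory.EllipticCurves Literature.NumberTheory.EllipticCurves.HuShuYin2019
  Summit.BirchSwinnertonDyer.BirchSwinnertonDyer.Theorems.SylvesterTwoYin

namespace Summit.BirchSwinnertonDyer.BirchSwinnertonDyer.Theorems.SylvesterTwoYinToric

/-- **THE TRACE RELATION AT `2` (reading of MEMO v2.10 §52 Lemmas A–C).** For a Weierstrass model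
`B/ℚ`, an extension of fields `L/K` with a `K`-automorphism `c` of `L`, an additive endomorphism `θ`
of `B(L)` (the CM unit `[ζ]`, `ζ = ξ(2)⁻¹ ∈ μ₃`), an integer `N`, a point `Y ∈ B(K)` and points
`R, T ∈ B(L)`: `N • ι(Y) = −θ(R + c•R) + T` (`ι : B(K) → B(L)` the inclusion). In the source:
`N = 9`, `ι(Y) ↔ [√−3]Z_p`, `R = Tr_{F_Γ(x″)/K(i)} ϕφ([τ_r/4])`, `T` torsion — from `a₂(f) = 0`
(the exact identity `F(τ/4) + F((τ+2)/4) + ξ(2)F(τ) = 0`) and Shimura reciprocity for the CM points of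
`2`-conductor `4` on `X₁(27p)` (Yin, arXiv:2607.01744 §2; MEMO v2.10 §52.2–52.4). A predicate; nothing
asserted. [cite-level reading: arXiv:2607.01744 §2 (2.0.2)–(2.0.8), Thm. 2.2; MEMO bsd-cm-two v2.10 §52] -/
def TraceRelationAtTwo (B : WeierstrassCurve ℚ) (K L : Type) [Field K] [CharZero K] [Field L] [CharZero L]
    [Algebra K L]
    (c : L ≃ₐ[K] L) (θ : (B.baseChange L).toAffine.Point →+ (B.baseChange L).toAffine.Point) (N : ℤ)
    (Y : (B.baseChange K).toAffine.Point) (R T : (B.baseChange L).toAffine.Point) : Prop :=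
  N • Affine.Point.baseChange (W' := B) K L Y =
    -(θ (R + Affine.Point.map (W' := B) (c : L →ₐ[K] L) R)) + T

/-- **THE ANTI-TRACE IS TORSION (reading of MEMO v2.10 §52 Lemmas D–E).** `R − c•R` has finite order.
In the source: `(1 − c)R` is a positive multiple of the Yuan–Zhang–Zhang toric period `P_{χκ}(ρ(β″)φ_A)`
for the sextic character `χκ` (`κ` = the quadratic character of `K(i)/K`), and the pair `(π_f, χκ)` has
Tunnell–Saito set `Σ = {3, ∞} ≠ Σ(𝔹) = {∞}` for `p ≡ 7 (9)` (the `ε`-factor at `3` flips: `√−3` is inert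
in `K(i)` and `f₃(E_p) = 2`), so `𝒫(π_A, χκ) = 0` and every such period vanishes (YZZ13 §1.3.2, Thm. 1.3).
A predicate; nothing asserted.
[cite-level reading: Yuan–Zhang–Zhang 2013 §1.3.2, §1.4.1 Thm. 1.3; MEMO bsd-cm-two v2.10 §52.5–52.6] -/
def AntiTraceIsTorsion (B : WeierstrassCurve ℚ) (K L : Type) [Field K] [CharZero K] [Field L] [CharZero L]
    [Algebra K L]
    (c : L ≃ₐ[K] L) (R : (B.baseChange L).toAffine.Point) : Prop :=
  IsOfFinAddOrder (R - Affine.Point.map (W' := B) (c : L →ₐ[K] L) R)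

/-- **YIN'S POINT DECOMPOSES TORICALLY (hypothesis shape = the typed reading of the C′ mechanism,
MEMO v2.10 §51–§52; the cell's DERIVED-CLAIM OF RECORD for stub (C′), planner D138).** For every prime
`p ≡ 7 (mod 9)`, every globally minimal `B ≅ E_p` with `#Ш_an(B) = qB`, every quadratic number field
`K ∋ ω` with `rank_ℤ B(K) = 2` and every rational point `P` generating `B(ℚ)` modulo torsion, there are
ONE point `Y ∈ B(K)` and a `2`-adic unit `u ∈ ℚ` in Yin's display position
`(u·qB)·ĥ_K(ι P) = 2⁻²·ĥ_K(Y)` (arXiv:2607.01744 Thm. 1.1 + (3.5.3) for `Y = ψ([√−3]Z_p)`, PREPRINT), AND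
toric data for the SAME point: a Galois extension `L/K` with `Gal(L/K) = {1, c}` (source: `L = K(i)`),
in which `B` has no point of order `2` (source: `ℚ(E_p[2]) = ℚ(ω, ∛(4p))` has degree `6 ∤ 4`), an
additive `θ` (the CM unit), an ODD `N` (source: `9`) and `R, T ∈ B(L)`, `T` torsion, with
`TraceRelationAtTwo` (Lemmas A–C) and `AntiTraceIsTorsion` (Lemmas D–E). CONSEQUENCE (companion file,
kernel): `Y ∈ 2B(K) + tors`, hence C′ / item 19802. NOT a Literature fact; NOT asserted; pending referee.
[cite-level reading: arXiv:2607.01744 Thm. 1.1, Thm. 2.2; Yuan–Zhang–Zhang 2013 §1.3.2; MEMO bsd-cm-two v2.10 §52] -/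
@[conjecture] def YinToricDecomposition : Prop :=
  ∀ (p : ℕ), p.Prime → p % 9 = 7 →
    ∀ (B : WeierstrassCurve ℚ) [B.IsElliptic] [B.IsGloballyMinimal],
    (∃ C : VariableChange ℚ, C • B = cubeSumCurve (p : ℚ)) → ∀ (qB : ℚ), shaAn B = (qB : ℂ) →
    ∀ (K : Type) [Field K] [NumberField K] (ω : K), ω ^ 2 + ω + 1 = 0 → Module.finrank ℚ K = 2 →
      (B.baseChange K).mordellWeilRank = 2 →
    ∀ (P : B.toAffine.Point), ¬ IsOfFinAddOrder (QuadraticDescent.incl K B P) →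
      (∀ Q : B.toAffine.Point, ∃ m : ℤ,
        IsOfFinAddOrder (QuadraticDescent.incl K B Q - m • QuadraticDescent.incl K B P)) →
    ∃ (Y : (B.baseChange K).toAffine.Point) (u : ℚ), u ≠ 0 ∧ padicValRat 2 u = 0 ∧
      ((u * qB : ℚ) : ℝ) * canonicalHeight (QuadraticDescent.incl K B P) =
        (2 : ℝ) ^ (-2 : ℤ) * canonicalHeight Y ∧
      ∃ (L : Type) (_ : Field L) (_ : NumberField L) (_ : Algebra K L) (_ : IsGalois K L)
        (c : L ≃ₐ[K] L) (θ : (B.baseChange L).toAffine.Point →+ (B.baseChange L).toAffine.Point)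
        (N : ℤ) (R T : (B.baseChange L).toAffine.Point),
        (∀ σ : L ≃ₐ[K] L, σ = AlgEquiv.refl ∨ σ = c) ∧
        (∀ Q : (B.baseChange L).toAffine.Point, (2 : ℕ) • Q = 0 → Q = 0) ∧
        Odd N ∧ IsOfFinAddOrder T ∧
        TraceRelationAtTwo B K L c θ N Y R T ∧ AntiTraceIsTorsion B K L c R

/-- **The planner's binder for the toric road to C′ (D138 (c)).** Yin's display (`YinHeightDisplay`,
PREPRINT — equivalently the landed PRE claim `Yin2026.thm11_heightDisplay_PRE` via
`yinHeightDisplay_of_thm11_PRE`) AND the toric decomposition of Yin's point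
(`YinToricDecomposition`, the cell's DERIVED-CLAIM). Consumers: `yinPointTwoDivisibleSevenModNine_of_toric`
(C′) and `hsyPointTwoDivisibleSevenModNine_of_factsPlus_of_toric` (item 19802) in the companion file.
Nothing asserted. [cite-level reading: arXiv:2607.01744 Thm. 1.1; MEMO bsd-cm-two v2.10 §51] -/
@[conjecture] def PublishedFactsTwoYinToric : Prop :=
  YinHeightDisplay ∧ YinToricDecomposition

end Summit.BirchSwinnertonDyer.BirchSwinnertonDyer.Theorems.SylvesterTwoYinToric

end
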